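import Summits.Parity.BatemanHorn.Theorems.AlmostPrimeZerosSystemMomentDeficitAssemblyAlgebra
import HarnessLib

/-!
# Crux `SystemMomentDeficit` (stmt-Parity-11326), line `Ideator3Sketch`: K1 for linear systems (rough pairs)

The decorrelated covariance bound `Cov(W, N) ≥ −C` (registered stub
`stub_decorrelatedCovarianceBound`, the crux's analytic core) needs no arithmetic input when every
member of the system is LINEAR: a value `fᵢ(n) = aᵢ n + bᵢ ≤ Aᵢ x` (`0 ≤ n ≤ x`) has a prime
factor `p > x` only if `fᵢ(n) = p·c` with `c < Aᵢ`, and for each `c` the map `n ↦ p` is injective,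
so `Σ_{n ≤ x} N(n) ≤ Σᵢ Aᵢ (π(Aᵢ x) + √(Aᵢ x) + 1) ≪ x / log x` (Chebyshev), while
`|W(n)| ≤ 2 Σᵢ log₂ (Aᵢ x) ≪ log x`; hence `|Cov(W, N)| ≤ 2 sup|W| · E N = O(1)`.

Main results:
* `sum_roughCount_le_of_natDegree_eq_one` — `Σ_{n ≤ x} (s(g(n)⁺) − #{q ∈ PP(x) : q ∣ g(n)⁺}) ≤ A(π(Ax) + √(Ax) + 1)`
  for `g` of degree `1` with positive leading coefficient, `A = 2 Σ_j |coeff_j g|`;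
* `decorrelatedCovarianceBound_of_natDegree_eq_one` — K1 for all-linear Bateman–Horn systems.

Notation (docstrings only).  `Y = x + 1`, `E g = Y⁻¹ Σ_{0 ≤ n ≤ x} g(n)`, `PP(z)` = primes `≤ z` ∪
prime squares `≤ z`, `s(m) = Σ_{p^v ∥ m} min(v, 2)`.  Everything is [folklore].
-/

namespace Summit.Parity.BatemanHorn.Cruxes.SystemMomentDeficit.Ideator3Sketch

open scoped BigOperators
open Finset Polynomial
open Literature.NumberTheory.Sieve
open Summit.Parity.BatemanHorn.Theorems.AlmostPrimeZeros.SystemMertens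

/-! ### Prime factors are few: the small count is `≤ 2 log₂ m` -/

/-- The small count at any height is at most `2 log₂ m`:
`#{q ∈ PP(y) : q ∣ m ≠ 0} ≤ 2 · Nat.log 2 m`. [folklore] -/
theorem card_PP_filter_le_two_mul_log (y m : ℕ) :
    #((Nat.primesLE y ∪ ((Nat.primesLE y).filter (fun p => p ^ 2 ≤ y)).image (fun p => p ^ 2)).filter
      (fun q => q ∣ m ∧ m ≠ 0)) ≤ 2 * Nat.log 2 m := by
  rw [card_PP_filter_dvd]
  have h1 : #(m.primeFactors.filter (fun p => p ≤ y)) ≤ #m.primeFactors := card_le_card (filter_subset _ _)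
  have h2 : #(m.primeFactors.filter (fun p => p ^ 2 ∣ m ∧ p ^ 2 ≤ y)) ≤ #m.primeFactors :=
    card_le_card (filter_subset _ _)
  have h3 : #m.primeFactors ≤ Nat.log 2 m := by
    rcases eq_or_ne m 0 with rfl | hm
    · simp
    refine Nat.le_log_of_pow_le one_lt_two ?_
    exact pow_card_le_of_forall (e := 1) hm m.primeFactors fun p hp =>
      ⟨hp, (Nat.prime_of_mem_primeFactors hp).factorization_pos_of_dvd hm (Nat.dvd_of_mem_primeFactors hp),
        by rw [pow_one]; exact (Nat.prime_of_mem_primeFactors hp).two_le⟩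
  omega

/-! ### The rough count along a linear polynomial -/

/-- Pointwise, the rough count is the number of prime factors `> x` plus the number of prime-square
factors `> x`: `s(m) − #{q ∈ PP(x) : q ∣ m ≠ 0} = #{p ∣ m : x < p} + #{p ∣ m : p² ∣ m, x < p²}`.
[folklore] -/
theorem capped_sub_card_PP_filter_eq (x m : ℕ) :
    (m.factorization.sum fun _ v => min v 2) -
        #((Nat.primesLE x ∪ ((Nat.primesLE x).filter (fun p => p ^ 2 ≤ x)).image (fun p => p ^ 2)).filter
          (fun q => q ∣ m ∧ m ≠ 0)) =
      #(m.primeFactors.filter (fun p => x < p)) +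
        #(m.primeFactors.filter (fun p => p ^ 2 ∣ m ∧ x < p ^ 2)) := by
  rw [card_PP_filter_dvd, capped_eq_card_add_card]
  have hA : #(m.primeFactors.filter (fun p => p ≤ x)) + #(m.primeFactors.filter (fun p => x < p)) =
      #m.primeFactors := by
    rw [← card_union_of_disjoint (disjoint_filter.2 fun p _ h1 h2 => absurd h1 (not_le.2 h2))]
    congr 1
    ext p
    simp only [mem_union, mem_filter]
    constructor
    · rintro (⟨h, -⟩ | ⟨h, -⟩) <;> exact h
    · intro h
      rcases le_or_gt p x with h' | h'
      · exact Or.inl ⟨h, h'⟩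
      · exact Or.inr ⟨h, h'⟩
  have hB : #(m.primeFactors.filter (fun p => p ^ 2 ∣ m ∧ p ^ 2 ≤ x)) +
      #(m.primeFactors.filter (fun p => p ^ 2 ∣ m ∧ x < p ^ 2)) =
      #(m.primeFactors.filter (fun p => p ^ 2 ∣ m)) := by
    rw [← card_union_of_disjoint (disjoint_filter.2 fun p _ h1 h2 => absurd h1.2 (not_le.2 h2.2))]
    congr 1
    ext p
    simp only [mem_union, mem_filter]
    constructor
    · rintro (⟨h, h2, -⟩ | ⟨h, h2, -⟩) <;> exact ⟨h, h2⟩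
    · rintro ⟨h, h2⟩
      rcases le_or_gt (p ^ 2) x with h' | h'
      · exact Or.inl ⟨h, h2, h'⟩
      · exact Or.inr ⟨h, h2, h'⟩
  omega

/-- A polynomial of degree `1` with positive leading coefficient is strictly increasing on `ℕ`,
hence injective: `g(n) = g(n') ⇒ n = n'`. [folklore] -/
theorem eval_natCast_injective_of_natDegree_eq_one {g : ℤ[X]} (hdeg : g.natDegree = 1)
    (hlc : 0 < g.leadingCoeff) : Function.Injective fun n : ℕ => g.eval (n : ℤ) := by
  have key : ∀ t : ℤ, g.eval t = g.coeff 0 + g.leadingCoeff * t := by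
    intro t
    rw [eval_eq_sum_range' (show g.natDegree < 2 by omega), Finset.sum_range_succ,
      Finset.sum_range_one, Polynomial.leadingCoeff, hdeg]
    ring
  intro n n' h
  simp only [key] at h
  have h1 : g.leadingCoeff * ((n : ℤ) - n') = 0 := by linarith
  rcases mul_eq_zero.1 h1 with h2 | h2
  · exact absurd h2 hlc.ne'
  · exact_mod_cast (sub_eq_zero.1 h2)

/-- Size of the values of a degree-`1` polynomial on `0 ≤ n ≤ x`, `x ≥ 1`:
`g(n)⁺ ≤ (Σ_j |coeff_j g|)·(x+1) ≤ A x` with `A = 2 Σ_j |coeff_j g|`. [folklore] -/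
theorem toNat_eval_le_mul_of_natDegree_eq_one {g : ℤ[X]} (hdeg : g.natDegree = 1) {n x : ℕ}
    (hx : 1 ≤ x) (hn : n ≤ x) :
    (g.eval (n : ℤ)).toNat ≤ (2 * ∑ j ∈ range (g.natDegree + 1), (g.coeff j).natAbs) * x := by
  have h := toNat_eval_le g hn
  rw [hdeg, pow_one] at h
  rw [hdeg]
  calc (g.eval (n : ℤ)).toNat ≤ (∑ j ∈ range (1 + 1), (g.coeff j).natAbs) * (x + 1) := h
    _ ≤ (∑ j ∈ range (1 + 1), (g.coeff j).natAbs) * (2 * x) := Nat.mul_le_mul_left _ (by omega)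
    _ = (2 * ∑ j ∈ range (1 + 1), (g.coeff j).natAbs) * x := by ring

/-- **Rough pairs along a linear polynomial.**  For `g` of degree `1` with positive leading
coefficient and `x ≥ 1`, with `A = 2 Σ_j |coeff_j g|`:
`Σ_{n ≤ x} (s(g(n)⁺) − #{q ∈ PP(x) : q ∣ g(n)⁺ ≠ 0}) ≤ A · (π(A x) + (√(A x) + 1))`
(a prime `p > x` or a prime square `p² > x` dividing `g(n)⁺ ≤ A x` has cofactor `c < A`, and for
each `c` the map `n ↦ p` is injective). [folklore] -/
theorem sum_roughCount_le_of_natDegree_eq_one :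
    ∀ (g : ℤ[X]), g.natDegree = 1 → 0 < g.leadingCoeff → ∀ (x : ℕ), 1 ≤ x →
    ∑ n ∈ range (x + 1), ((((g.eval (n : ℤ)).toNat.factorization.sum fun _ v => min v 2) : ℕ) -
        #((Nat.primesLE x ∪ ((Nat.primesLE x).filter (fun p => p ^ 2 ≤ x)).image (fun p => p ^ 2)).filter
          (fun q => q ∣ (g.eval (n : ℤ)).toNat ∧ (g.eval (n : ℤ)).toNat ≠ 0))) ≤
      (2 * ∑ j ∈ range (g.natDegree + 1), (g.coeff j).natAbs) *
        (Nat.primeCounting ((2 * ∑ j ∈ range (g.natDegree + 1), (g.coeff j).natAbs) * x) +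
          (Nat.sqrt ((2 * ∑ j ∈ range (g.natDegree + 1), (g.coeff j).natAbs) * x) + 1)) := by
  intro g hdeg hlc x hx
  classical
  set A : ℕ := 2 * ∑ j ∈ range (g.natDegree + 1), (g.coeff j).natAbs with hA
  set m : ℕ → ℕ := fun n => (g.eval (n : ℤ)).toNat with hm
  have hmA : ∀ n ∈ range (x + 1), m n ≤ A * x := fun n hn =>
    toNat_eval_le_mul_of_natDegree_eq_one hdeg hx (Nat.lt_succ_iff.1 (mem_range.1 hn))
  have hinj := eval_natCast_injective_of_natDegree_eq_one hdeg hlc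
  -- injectivity of `n ↦ m n` on the `n` with `m n ≠ 0`
  have hminj : ∀ n n', m n ≠ 0 → m n = m n' → n = n' := by
    intro n n' h0 h
    apply hinj
    simp only [hm] at h h0
    have h1 : 0 < g.eval (n : ℤ) := by
      by_contra hle
      exact h0 (Int.toNat_eq_zero.2 (not_lt.1 hle))
    have h2 : 0 < g.eval (n' : ℤ) := by
      by_contra hle
      rw [Int.toNat_eq_zero.2 (not_lt.1 hle)] at h
      exact h0 h
    have := congrArg (fun t : ℕ => (t : ℤ)) h
    simpa [Int.toNat_of_nonneg h1.le, Int.toNat_of_nonneg h2.le] using this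
  simp_rw [capped_sub_card_PP_filter_eq]
  rw [sum_add_distrib, mul_add]
  refine Nat.add_le_add ?_ ?_
  · -- primes `p > x`: inject `(n, p) ↦ (m n / p, p)` into `range A × primesLE (A x)`
    rw [← card_sigma]
    calc #((range (x + 1)).sigma fun n => (m n).primeFactors.filter (fun p => x < p))
        ≤ #((range A) ×ˢ Nat.primesLE (A * x)) := by
          refine card_le_card_of_injOn (fun np => (m np.1 / np.2, np.2)) ?_ ?_
          · rintro ⟨n, p⟩ hnp
            simp only [coe_sigma, Set.mem_sigma_iff, mem_coe, mem_filter, Nat.mem_primeFactors] at hnp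
            obtain ⟨hn, ⟨hp, hpm, hm0⟩, hxp⟩ := hnp
            rw [mem_coe, mem_product, mem_range, Nat.mem_primesLE]
            have hmle := hmA n hn
            refine ⟨?_, (Nat.le_of_dvd (Nat.pos_of_ne_zero hm0) hpm).trans hmle, hp⟩
            -- `m n / p < A` since `m n ≤ A x < A p`... via `m n / p * p ≤ m n ≤ A x` and `x < p`
            have hx0 : 0 < x := hx
            by_contra hge
            rw [not_lt] at hge
            have h1 : A * p ≤ m n / p * p := Nat.mul_le_mul_right p hge
            have h2 : m n / p * p ≤ m n := Nat.div_mul_le_self (m n) p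
            have hA0 : 0 < A := by
              by_contra hA0
              have : A = 0 := by omega
              rw [this, zero_mul] at hmle
              exact hm0 (by omega)
            nlinarith
          · rintro ⟨n, p⟩ hnp ⟨n', p'⟩ hnp' h
            simp only [Prod.mk.injEq] at h
            obtain ⟨hc, rfl⟩ := h
            simp only [coe_sigma, Set.mem_sigma_iff, mem_coe, mem_filter, Nat.mem_primeFactors] at hnp hnp'
            have e1 : m n = m n / p * p := (Nat.div_mul_cancel hnp.2.1.2.1).symm
            have e2 : m n' = m n' / p * p := (Nat.div_mul_cancel hnp'.2.1.2.1).symm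
            have : n = n' := hminj n n' hnp.2.1.2.2 (by rw [e1, e2, hc])
            subst this
            rfl
      _ = A * Nat.primeCounting (A * x) := by
          rw [card_product, card_range, Nat.primesLE_card_eq_primeCounting]
  · -- prime squares `p² > x`: inject `(n, p) ↦ (m n / p², p)` into `range A × range (√(A x) + 1)`
    rw [← card_sigma]
    calc #((range (x + 1)).sigma fun n => (m n).primeFactors.filter (fun p => p ^ 2 ∣ m n ∧ x < p ^ 2))
        ≤ #((range A) ×ˢ range (Nat.sqrt (A * x) + 1)) := by
          refine card_le_card_of_injOn (fun np => (m np.1 / np.2 ^ 2, np.2)) ?_ ?_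
          · rintro ⟨n, p⟩ hnp
            simp only [coe_sigma, Set.mem_sigma_iff, mem_coe, mem_filter, Nat.mem_primeFactors] at hnp
            obtain ⟨hn, ⟨hp, hpm, hm0⟩, hp2, hxp⟩ := hnp
            rw [mem_coe, mem_product, mem_range, mem_range, Nat.lt_succ_iff, Nat.le_sqrt]
            have hmle := hmA n hn
            refine ⟨?_, ?_⟩
            · by_contra hge
              rw [not_lt] at hge
              have h1 : A * p ^ 2 ≤ m n / p ^ 2 * p ^ 2 := Nat.mul_le_mul_right _ hge
              have h2 : m n / p ^ 2 * p ^ 2 ≤ m n := Nat.div_mul_le_self (m n) (p ^ 2)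
              have hA0 : 0 < A := by
                by_contra hA0
                have : A = 0 := by omega
                rw [this, zero_mul] at hmle
                exact hm0 (by omega)
              nlinarith
            · rw [← pow_two]
              exact (Nat.le_of_dvd (Nat.pos_of_ne_zero hm0) hp2).trans hmle
          · rintro ⟨n, p⟩ hnp ⟨n', p'⟩ hnp' h
            simp only [Prod.mk.injEq] at h
            obtain ⟨hc, rfl⟩ := h
            simp only [coe_sigma, Set.mem_sigma_iff, mem_coe, mem_filter, Nat.mem_primeFactors] at hnp hnp'
            have e1 : m n = m n / p ^ 2 * p ^ 2 := (Nat.div_mul_cancel hnp.2.2.1).symm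
            have e2 : m n' = m n' / p ^ 2 * p ^ 2 := (Nat.div_mul_cancel hnp'.2.2.1).symm
            have : n = n' := hminj n n' hnp.2.1.2.2 (by rw [e1, e2, hc])
            subst this
            rfl
      _ = A * (Nat.sqrt (A * x) + 1) := by rw [card_product, card_range, card_range]

/-! ### Chebyshev and elementary real estimates -/

/-- Chebyshev's bound in the form `π(M) ≤ 2 log 4 · M / log M + √M` for naturals `M ≥ 2`
(Mathlib `Chebyshev.pi_le_log4_mul_div`). [folklore] -/
theorem primeCounting_le_of_two_le {M : ℕ} (hM : 2 ≤ M) :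
    (Nat.primeCounting M : ℝ) ≤ 2 * Real.log 4 * M / Real.log M + Real.sqrt M := by
  have hM1 : (1 : ℝ) < M := by exact_mod_cast hM
  have hM0 : (0 : ℝ) < M := by linarith
  have h := Chebyshev.pi_le_log4_mul_div hM1
  rw [Nat.floor_natCast, Real.log_sqrt hM0.le] at h
  have hlog : 0 < Real.log M := Real.log_pos hM1
  calc (Nat.primeCounting M : ℝ) ≤ Real.log 4 * M / (Real.log M / 2) + Real.sqrt M := h
    _ = 2 * Real.log 4 * M / Real.log M + Real.sqrt M := by field_simp

/-- `√x ≤ 2x / log x` for real `x > 1` (`log x ≤ 2√x`). [folklore] -/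
theorem sqrt_le_two_mul_div_log {x : ℝ} (hx : 1 < x) : Real.sqrt x ≤ 2 * x / Real.log x := by
  have hx0 : 0 < x := by linarith
  have hlog : 0 < Real.log x := Real.log_pos hx
  rw [le_div_iff₀ hlog]
  have h1 : Real.log x ≤ x ^ (1 / 2 : ℝ) / (1 / 2) := Real.log_le_rpow_div hx0.le (by norm_num)
  rw [← Real.sqrt_eq_rpow] at h1
  have hst : Real.sqrt x * Real.sqrt x = x := Real.mul_self_sqrt hx0.le
  have hs0 : 0 ≤ Real.sqrt x := Real.sqrt_nonneg x
  nlinarith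

/-- The rough-pair bound of a linear member in closed form: for `A ≥ 1` and `x ≥ 16`,
`A (π(Ax) + √(Ax) + 1) ≤ 8 A² x / log x`. [folklore] -/
theorem roughPairs_bound_le {A x : ℕ} (hA : 1 ≤ A) (hx : 16 ≤ x) :
    ((A * (Nat.primeCounting (A * x) + (Nat.sqrt (A * x) + 1)) : ℕ) : ℝ) ≤
      8 * (A : ℝ) ^ 2 * x / Real.log x := by
  have hAR : (1 : ℝ) ≤ A := by exact_mod_cast hA
  have hxR : (16 : ℝ) ≤ x := by exact_mod_cast hx
  have hx1 : (1 : ℝ) < x := by linarith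
  have hx0 : (0 : ℝ) < x := by linarith
  have hlogx : 0 < Real.log x := Real.log_pos hx1
  have hlogx1 : 1 ≤ Real.log x := by
    rw [Real.le_log_iff_exp_le hx0]
    have := Real.exp_one_lt_d9
    linarith
  have hAx2 : 2 ≤ A * x := le_trans (by norm_num) (Nat.mul_le_mul hA hx)
  have hπ := primeCounting_le_of_two_le hAx2
  push_cast at hπ ⊢
  -- `log (A x) ≥ log x`
  have hAx0 : (0 : ℝ) < (A : ℝ) * x := by positivity
  have hlogAx : Real.log x ≤ Real.log ((A : ℝ) * x) :=
    Real.log_le_log hx0 (by nlinarith)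
  have hlogAx0 : 0 < Real.log ((A : ℝ) * x) := hlogx.trans_le hlogAx
  -- `√(A x) ≤ A √x ≤ 2 A x / log x`
  have hsqrtx := sqrt_le_two_mul_div_log hx1
  have hsqrtAx : Real.sqrt ((A : ℝ) * x) ≤ (A : ℝ) * Real.sqrt x := by
    rw [Real.sqrt_le_left (by positivity), mul_pow, Real.sq_sqrt hx0.le]
    nlinarith
  have hnsqrt : ((Nat.sqrt (A * x) : ℕ) : ℝ) ≤ Real.sqrt ((A : ℝ) * x) := by
    rw [Real.le_sqrt (by positivity) (by positivity)]
    exact_mod_cast Nat.sqrt_le' (A * x)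
  -- `1 ≤ x / log x`
  have hone : (1 : ℝ) ≤ x / Real.log x := by
    rw [le_div_iff₀ hlogx, one_mul]
    exact (Real.log_le_sub_one_of_pos hx0).trans (by linarith)
  -- `2 log 4 ≤ 3`
  have hlog4 : 2 * Real.log 4 ≤ 3 := by
    have h2 : Real.log 2 ≤ 0.6931471808 := Real.log_two_lt_d9.le
    have h4 : Real.log 4 = 2 * Real.log 2 := by
      rw [show (4 : ℝ) = 2 ^ 2 by norm_num, Real.log_pow]; push_cast; ring
    linarith
  -- main term
  have hmain : 2 * Real.log 4 * ((A : ℝ) * x) / Real.log ((A : ℝ) * x) ≤ 3 * (A : ℝ) * x / Real.log x := by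
    calc 2 * Real.log 4 * ((A : ℝ) * x) / Real.log ((A : ℝ) * x)
        ≤ 2 * Real.log 4 * ((A : ℝ) * x) / Real.log x :=
          div_le_div_of_nonneg_left (by positivity) hlogx hlogAx
      _ ≤ 3 * ((A : ℝ) * x) / Real.log x := by
          refine div_le_div_of_nonneg_right ?_ hlogx.le
          exact mul_le_mul_of_nonneg_right hlog4 (by positivity)
      _ = 3 * (A : ℝ) * x / Real.log x := by ring
  have hsq : Real.sqrt ((A : ℝ) * x) ≤ 2 * (A : ℝ) * x / Real.log x := by
    calc Real.sqrt ((A : ℝ) * x) ≤ (A : ℝ) * Real.sqrt x := hsqrtAx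
      _ ≤ (A : ℝ) * (2 * x / Real.log x) := mul_le_mul_of_nonneg_left hsqrtx (by positivity)
      _ = 2 * (A : ℝ) * x / Real.log x := by ring
  have hone' : (1 : ℝ) ≤ (A : ℝ) * x / Real.log x := by
    calc (1 : ℝ) ≤ x / Real.log x := hone
      _ ≤ (A : ℝ) * (x / Real.log x) := le_mul_of_one_le_left (by positivity) hAR
      _ = (A : ℝ) * x / Real.log x := by ring
  have htot : ((Nat.primeCounting (A * x) : ℕ) : ℝ) + (((Nat.sqrt (A * x) : ℕ) : ℝ) + 1) ≤
      8 * (A : ℝ) * x / Real.log x := by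
    have h1 : ((Nat.primeCounting (A * x) : ℕ) : ℝ) ≤ 5 * (A : ℝ) * x / Real.log x := by
      calc ((Nat.primeCounting (A * x) : ℕ) : ℝ)
          ≤ 2 * Real.log 4 * ((A : ℝ) * x) / Real.log ((A : ℝ) * x) + Real.sqrt ((A : ℝ) * x) := hπ
        _ ≤ 3 * (A : ℝ) * x / Real.log x + 2 * (A : ℝ) * x / Real.log x := add_le_add hmain hsq
        _ = 5 * (A : ℝ) * x / Real.log x := by ring
    have h2 : ((Nat.sqrt (A * x) : ℕ) : ℝ) + 1 ≤ 3 * (A : ℝ) * x / Real.log x := by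
      calc ((Nat.sqrt (A * x) : ℕ) : ℝ) + 1 ≤ 2 * (A : ℝ) * x / Real.log x + (A : ℝ) * x / Real.log x :=
            add_le_add (hnsqrt.trans hsq) hone'
        _ = 3 * (A : ℝ) * x / Real.log x := by ring
    calc _ ≤ 5 * (A : ℝ) * x / Real.log x + 3 * (A : ℝ) * x / Real.log x := add_le_add h1 h2
      _ = 8 * (A : ℝ) * x / Real.log x := by ring
  calc (A : ℝ) * (((Nat.primeCounting (A * x) : ℕ) : ℝ) + (((Nat.sqrt (A * x) : ℕ) : ℝ) + 1))
      ≤ (A : ℝ) * (8 * (A : ℝ) * x / Real.log x) := mul_le_mul_of_nonneg_left htot (by positivity)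
    _ = 8 * (A : ℝ) ^ 2 * x / Real.log x := by ring

end Summit.Parity.BatemanHorn.Cruxes.SystemMomentDeficit.Ideator3Sketch
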